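import Summits.QuantumFields.YangMills.Theorems.FluctuationComparisonRegPrIntLClassicalPerHeightSteps
import Literature.MathematicalPhysics.QuantumFieldTheory.Balaban1983to89.T3CurvGradLog
import HarnessLib

/-!
# S2α′ · `ClassicalPerHeight` from EXW∘ — FILE 2∕3: THE TWO ONE-STEP COMPARISONS AT FIXED HEIGHT WITH GOOD-HISTORY COMPETITORS (UPPER by the smooth exact lift of the
# regular good-history minimiser, LOWER by the one-step average of the next run's), the summable radius, and THE STEP AT POSITIVE DEPTH from EXW∘'s two clauses

Cell `ym3-torus` (HUMAN RULING D-0037; rung R3 = continuum `SU(2)` Yang–Mills on the three-torus at fixed lattice data — NOT d = 4, NOT infinite volume, NOT a mass gap,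
NOT Clay).  Width seat `ym3-torus-px17` (gen 18); crux `stmt-QuantumFields-20520`; `--kind proof --supports stmt-QuantumFields-20520 --as helper`, count-neutral;
DEFINITION-FREE (0 `def`, 0 `instance`, 0 `notation`, 0 `sorry`, default heartbeats).  FILE 1∕3 = ✓`…ClassicalPerHeightSteps` (bookkeeping ∕ arithmetic); the story and the
doors are in FILE 3∕3 `…ClassicalPerHeightOfWindowExactness`.

THE POINT.  The 19200 two-run chain (lit `T3UpperLiftSplitLog` ∕ `T3SplitLog`) places its competitors in print's space (6)(ε₀) of the other run, whose DIVERGENCE clause (1.9) is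
fed by the log-Lipschitz curvature gradient `B₄ε₁((K−n)+1)L^{−3(K−n)}` of (8)-regular fields (cell finding F-g12-1) — threshold `(K+2)·θBal(⌊K∕m⌋) ≤ σ`, impossible at FIXED
height.  Here the competitor only has to be a GOOD-HISTORY FIBRE ELEMENT (EXW∘ clause (1): `minActionRegPr ≤ A(U)` for every `U ∈ fibre ∩ histGood`), i.e. to satisfy PLAQUETTE
conditions level by level: the lift inherits the history below and meets the top window (`θBal` loses `L^{−1∕2}` per level against the lift's `L^{−2}`); the average inherits its
history outright.  The log factor is absorbed by `(k+1)L^{−k} ≤ 1`; the radii at fixed `J` are `C(L,F,γ,J)·(k+2)²·L^{−k}`.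

WHAT IS PROVED HERE (namespace `Summit.QuantumFields.YangMills.Theorems.FluctuationComparisonRegPrIntLClassicalPerHeightOneStep`; sorry-free, axioms standard).
* `ab_le`; ★ `upper_step` (✓`SmoothLift`'s schema `SmoothLiftAt`); ★ `lower_step` (✓`AvgActionDefect`'s schema `AvgActionDefectAt`); `upper_radius_le`, `lower_radius_le`, `step_radius_le`;
* ★★ `step_succ`: from EXW∘'s two clauses at `(J, J+k+1)` and `(J, J+k+2)` for ONE interior datum, Prop 8 (`MinimisersIn8At`), `CritCurvGradLogAt`, `SmoothLiftAt`, `AvgActionDefectAt`: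
  `|β_{K+1}·m_{K+1}(V) − β_K·m_K(V)| ≤ D·(k+3)²·x^{k+1}` (`K = J+k+1`, `D = (C₂+E₂)(B₄²+B₃B₄+B₃³)L^{3m}L^{4J}∕γ`).

HONEST.  Bookkeeping ∕ arithmetic ∕ compositions BY NAME of landed theorems; nothing of Bałaban's analysis is added; `stub_classicalPerHeight`, S2β, crux 20520, 19936, 19200 and
`YM3TorusSU2` are NOT proved here; rung R3 = SU(2) YM₃ on T³ at fixed lattice data — NOT d = 4, NOT infinite volume, NOT a mass gap, NOT Clay; the Yang–Mills mass gap is NOT proved.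

References: T. Bałaban, CMP **102** (1985) 277–309 [Balaban1985Variational] (Thm 1 (6)–(10) pp.278–279, Prop. 8 p.304); CMP **102** (1985) 255–275 [Balaban1985UV3] ((3), (5) p.256,
(7) p.257, (41) p.266); CMP **98** (1985) 17–51 [Balaban1985Averaging] (Props 3–4, (125) p.36); C. King, CMP **102** (1986) 649–677 [King1986] ((A.5) p.676); P. Federbush,
CMP **110** (1987) 293–309 [Federbush1987PhaseCellIII] (Thm 4.3 (4.5) p.299).
-/

set_option autoImplicit false

noncomputable section

namespace Summit.QuantumFields.YangMills.Theorems.FluctuationComparisonRegPrIntLClassicalPerHeightOneStep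

open MeasureTheory Filter Topology
open scoped Matrix.Norms.L2Operator BigOperators
open Literature.MathematicalPhysics.QuantumFieldTheory.Balaban1983to89
open Literature.MathematicalPhysics.QuantumFieldTheory.Balaban1983to89.T3ContinuumYM3Torus
open Literature.MathematicalPhysics.QuantumFieldTheory.Balaban1983to89.T3UnitLawDensityEML (ℰp)
open Literature.MathematicalPhysics.QuantumFieldTheory.Balaban1983to89.T3UnitScaleTilt
open Literature.MathematicalPhysics.QuantumFieldTheory.Balaban1983to89.T3TiltDescent
open Literature.MathematicalPhysics.QuantumFieldTheory.Balaban1983to89.T3ConstrainedMinimiser (fibre)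
open Literature.MathematicalPhysics.QuantumFieldTheory.Balaban1983to89.T3DescentFibreTower
open Literature.MathematicalPhysics.QuantumFieldTheory.Balaban1983to89.T3RegularMinimiser
open Literature.MathematicalPhysics.QuantumFieldTheory.Balaban1983to89.T3PrintedRegularMinimiser
open Literature.MathematicalPhysics.QuantumFieldTheory.Balaban1983to89.T3PrintedMinimiserExistence
open Literature.MathematicalPhysics.QuantumFieldTheory.Balaban1983to89.T3LowerAlongMinimisersSplit
open Literature.MathematicalPhysics.QuantumFieldTheory.Balaban1983to89.T3UpperAlongMinimisersSplit
open Literature.MathematicalPhysics.QuantumFieldTheory.Balaban1983to89.T3UpperLiftSplit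
open Literature.MathematicalPhysics.QuantumFieldTheory.Balaban1983to89.T3LowerActionSplit
open Literature.MathematicalPhysics.QuantumFieldTheory.Balaban1983to89.T3CurvGradLog
open Literature.MathematicalPhysics.QuantumFieldTheory.Balaban1983to89.B10Eq27TorusAxialLog (toUField unitsField)
open Literature.MathematicalPhysics.QuantumFieldTheory.Balaban1983to89.B10Eq68TorusRegularity (plaqFT covDerivT covDivT)
open Literature.MathematicalPhysics.QuantumFieldTheory.Balaban1983to89.T4Continuum
open Summit.QuantumFields.YangMills.Theorems.FluctuationComparisonRegPrIntLClassicalPerHeightSteps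

/-! ## §3 The two one-step comparisons at FIXED height with GOOD-HISTORY competitors (EXW∘ clause (1)): UPPER by the smooth exact lift of the
regular good-history minimiser, LOWER by the one-step average of the next run's regular good-history minimiser -/

section Steps

variable (F : T3Family)

/-- The defect sizes at depth `k`: `B₃θx^{2k} ≤ B₃θ`, `B₄θ(k+1)x^{3k} ≤ B₄θ`, and `a + b ≤ (B₃ + B₄)θx^{2k}` (local helper). [folklore] -/
theorem ab_le {B₃ B₄ θ : ℝ} (hB₃ : 0 ≤ B₃) (hB₄ : 0 ≤ B₄) (hθ : 0 ≤ θ) (k : ℕ) :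
    B₃ * θ * ((F.L : ℝ)⁻¹) ^ (2 * k) ≤ B₃ * θ ∧ B₄ * θ * ((k : ℝ) + 1) * ((F.L : ℝ)⁻¹) ^ (3 * k) ≤ B₄ * θ ∧
      B₃ * θ * ((F.L : ℝ)⁻¹) ^ (2 * k) + B₄ * θ * ((k : ℝ) + 1) * ((F.L : ℝ)⁻¹) ^ (3 * k) ≤ (B₃ + B₄) * θ * ((F.L : ℝ)⁻¹) ^ (2 * k) := by
  have hx0 : (0 : ℝ) ≤ (F.L : ℝ)⁻¹ := inv_nonneg.mpr (Nat.cast_nonneg _)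
  have hx1 : ((F.L : ℝ)⁻¹) ≤ 1 := inv_le_one_of_one_le₀ (by have := F.hL.2; exact_mod_cast (by omega : 1 ≤ F.L))
  have hx2k : ((F.L : ℝ)⁻¹) ^ (2 * k) ≤ 1 := pow_le_one₀ hx0 hx1
  have h3 := succ_mul_inv_pow_three_le F k
  have hB₄θ : 0 ≤ B₄ * θ := mul_nonneg hB₄ hθ
  have hb : B₄ * θ * ((k : ℝ) + 1) * ((F.L : ℝ)⁻¹) ^ (3 * k) ≤ B₄ * θ * ((F.L : ℝ)⁻¹) ^ (2 * k) := by
    rw [mul_assoc (B₄ * θ)]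
    exact mul_le_mul_of_nonneg_left h3 hB₄θ
  refine ⟨mul_le_of_le_one_right (mul_nonneg hB₃ hθ) hx2k, hb.trans (mul_le_of_le_one_right hB₄θ hx2k), ?_⟩
  calc B₃ * θ * ((F.L : ℝ)⁻¹) ^ (2 * k) + B₄ * θ * ((k : ℝ) + 1) * ((F.L : ℝ)⁻¹) ^ (3 * k)
      ≤ B₃ * θ * ((F.L : ℝ)⁻¹) ^ (2 * k) + B₄ * θ * ((F.L : ℝ)⁻¹) ^ (2 * k) := by linarith
    _ = (B₃ + B₄) * θ * ((F.L : ℝ)⁻¹) ^ (2 * k) := by ring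

/-- **UPPER AT FIXED HEIGHT**: `β_{K+1}·m_{K+1} ≤ β_K·m_K + β_K·defect_K` (`K = J + k`), the competitor at run `K+1` being the SMOOTH EXACT LIFT of the regular good-history
minimiser `U` of run `K` — a good history (levels `≤ K` inherited from `U`, top level from the lift's plaquette bound against `θBal(b₀')(K+1)`), admissible by EXW∘ (1);
`β_{K+1} = L·β_K` (lit ✓`scheme_β_succ`). [cite: King1986, (A.5) p.676; Balaban1985Variational, Thm 1 (8)-(10) p.279; Balaban1985UV3, (41) p.266] -/
theorem upper_step {L : ℕ} (hFL : F.L = L) {C₁ C₂ c : ℝ} (hC₁ : 0 ≤ C₁) (hSL : SmoothLiftAt L C₁ C₂ c)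
    {γ : ℝ} (hγ : 0 ≤ γ) {B₃ B₄ θ ε₀ : ℝ} (hB₃ : 0 ≤ B₃) (hB₄ : 0 ≤ B₄) (hθ : 0 ≤ θ) (hB₃c : B₃ * θ ≤ c) (hB₄c : B₄ * θ ≤ c)
    {Θ : ℕ → ℝ} (J k : ℕ) (htop : C₁ * ((B₃ + B₄) * θ * ((F.L : ℝ)⁻¹) ^ (2 * k)) ≤ Θ (J + k + 1))
    {V : GaugeField (F.P J) 0 (Matrix.specialUnitaryGroup (Fin 2) ℂ)} {U : GaugeField (F.P (J + k)) 0 (Matrix.specialUnitaryGroup (Fin 2) ℂ)}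
    (hUf : U ∈ fibre F ℰp J (J + k) (Nat.le_add_right J k) V) (hUa : PlaqSmall (B₃ * θ * ((F.L : ℝ)⁻¹) ^ (2 * k)) U)
    (hUh : U ∈ histGood F ℰp Θ (J + k) J) (hUm : wilsonAction4 U = minActionRegPr F J (J + k) (Nat.le_add_right J k) ε₀ V)
    (hgrad : ∀ (x : Site (F.P (J + k)) 0) (ν κ κ' : Fin (F.P (J + k)).d), κ ≠ κ' →
      ‖covDerivT 1 (unitsField (toUField U)) ν (plaqFT (unitsField (toUField U)) κ κ') x‖ ≤
        B₄ * θ * ((k : ℝ) + 1) * ((F.L : ℝ)⁻¹) ^ (3 * k))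
    (hE : ∀ W ∈ fibre F ℰp J (J + k + 1) (Nat.le_add_right J (k + 1)) V, W ∈ histGood F ℰp Θ (J + k + 1) J →
      minActionRegPr F J (J + k + 1) (Nat.le_add_right J (k + 1)) ε₀ V ≤ wilsonAction4 W) :
    (F.scheme ℰp γ).β (J + k + 1) * minActionRegPr F J (J + k + 1) (Nat.le_add_right J (k + 1)) ε₀ V ≤
      (F.scheme ℰp γ).β (J + k) * minActionRegPr F J (J + k) (Nat.le_add_right J k) ε₀ V +
        (F.scheme ℰp γ).β (J + k) * (C₂ * ((B₄ * θ * ((k : ℝ) + 1) * ((F.L : ℝ)⁻¹) ^ (3 * k)) ^ 2 +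
          (B₃ * θ * ((F.L : ℝ)⁻¹) ^ (2 * k)) * (B₄ * θ * ((k : ℝ) + 1) * ((F.L : ℝ)⁻¹) ^ (3 * k)) +
          (B₃ * θ * ((F.L : ℝ)⁻¹) ^ (2 * k)) ^ 3) * (F.L : ℝ) ^ (3 * (F.m + (J + k)))) := by
  have hL0 : (0 : ℝ) < F.L := by have := F.hL.2; exact_mod_cast (by omega : 0 < F.L)
  obtain ⟨hac', hbc', hab⟩ := ab_le F hB₃ hB₄ hθ k
  have ha0 : 0 ≤ B₃ * θ * ((F.L : ℝ)⁻¹) ^ (2 * k) := by positivity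
  have hb0 : 0 ≤ B₄ * θ * ((k : ℝ) + 1) * ((F.L : ℝ)⁻¹) ^ (3 * k) := by positivity
  obtain ⟨U'', hD, hP, -, hA⟩ := hSL F hFL (J + k) _ _ ha0 (hac'.trans hB₃c) hb0 (hbc'.trans hB₄c) U hUa hgrad
  -- the lift lies in the fibre of `V` and has a good history
  have hf : U'' ∈ fibre F ℰp J (J + k + 1) (Nat.le_add_right J (k + 1)) V := lift_mem_fibre F (Nat.le_add_right J k) hD hUf
  have htop' : PlaqSmall (Θ (J + k + 1)) U'' := fun p => (hP p).trans_le ((mul_le_mul_of_nonneg_left hab hC₁).trans htop)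
  have hh : U'' ∈ histGood F ℰp Θ (J + k + 1) J := histGood_of_lift_succ F hD hUh htop'
  have hmin := hE U'' hf hh
  -- `β_{K+1} = L·β_K`
  have hβ := F.scheme_β_nonneg ℰp hγ (J + k)
  rw [scheme_β_succ]
  calc (F.L : ℝ) * (F.scheme ℰp γ).β (J + k) * minActionRegPr F J (J + k + 1) (Nat.le_add_right J (k + 1)) ε₀ V
      = (F.scheme ℰp γ).β (J + k) * ((F.L : ℝ) * minActionRegPr F J (J + k + 1) (Nat.le_add_right J (k + 1)) ε₀ V) := by ring
    _ ≤ (F.scheme ℰp γ).β (J + k) * ((F.L : ℝ) * wilsonAction4 U'') :=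
        mul_le_mul_of_nonneg_left (mul_le_mul_of_nonneg_left hmin hL0.le) hβ
    _ ≤ (F.scheme ℰp γ).β (J + k) * (wilsonAction4 U + C₂ * ((B₄ * θ * ((k : ℝ) + 1) * ((F.L : ℝ)⁻¹) ^ (3 * k)) ^ 2 +
          (B₃ * θ * ((F.L : ℝ)⁻¹) ^ (2 * k)) * (B₄ * θ * ((k : ℝ) + 1) * ((F.L : ℝ)⁻¹) ^ (3 * k)) +
          (B₃ * θ * ((F.L : ℝ)⁻¹) ^ (2 * k)) ^ 3) * (F.L : ℝ) ^ (3 * (F.m + (J + k)))) := mul_le_mul_of_nonneg_left hA hβ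
    _ = _ := by rw [hUm]; ring

/-- **LOWER AT FIXED HEIGHT**: `β_K·m_K ≤ β_{K+1}·m_{K+1} + β_K·defect'_K` (`K = J + k`), the competitor at run `K` being the ONE-STEP AVERAGE of the regular good-history
minimiser `U′` of run `K+1` — in the fibre of `V` by the descent tower, a good history by inheritance, admissible by EXW∘ (1); the action by the averaging defect.
[cite: Federbush1987PhaseCellIII, Thm 4.3 (4.5) p.299; Balaban1985Variational, Thm 1 (8)-(10) p.279; Balaban1985UV3, (41) p.266] -/
theorem lower_step {L : ℕ} (hFL : F.L = L) {E₂ e : ℝ} (hAD : AvgActionDefectAt L E₂ e)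
    {γ : ℝ} (hγ : 0 ≤ γ) {B₃ B₄ θ ε₀ : ℝ} (hB₃ : 0 ≤ B₃) (hB₄ : 0 ≤ B₄) (hθ : 0 ≤ θ) (hB₃e : B₃ * θ ≤ e) (hB₄e : B₄ * θ ≤ e)
    {Θ : ℕ → ℝ} (J k : ℕ)
    {V : GaugeField (F.P J) 0 (Matrix.specialUnitaryGroup (Fin 2) ℂ)} {U' : GaugeField (F.P (J + k + 1)) 0 (Matrix.specialUnitaryGroup (Fin 2) ℂ)}
    (hU'f : U' ∈ fibre F ℰp J (J + k + 1) (Nat.le_add_right J (k + 1)) V) (hU'a : PlaqSmall (B₃ * θ * ((F.L : ℝ)⁻¹) ^ (2 * (k + 1))) U')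
    (hU'h : U' ∈ histGood F ℰp Θ (J + k + 1) J) (hU'm : wilsonAction4 U' = minActionRegPr F J (J + k + 1) (Nat.le_add_right J (k + 1)) ε₀ V)
    (hgrad' : ∀ (x : Site (F.P (J + k + 1)) 0) (ν κ κ' : Fin (F.P (J + k + 1)).d), κ ≠ κ' →
      ‖covDerivT 1 (unitsField (toUField U')) ν (plaqFT (unitsField (toUField U')) κ κ') x‖ ≤
        B₄ * θ * (((k + 1 : ℕ) : ℝ) + 1) * ((F.L : ℝ)⁻¹) ^ (3 * (k + 1)))
    (hE : ∀ W ∈ fibre F ℰp J (J + k) (Nat.le_add_right J k) V, W ∈ histGood F ℰp Θ (J + k) J →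
      minActionRegPr F J (J + k) (Nat.le_add_right J k) ε₀ V ≤ wilsonAction4 W) :
    (F.scheme ℰp γ).β (J + k) * minActionRegPr F J (J + k) (Nat.le_add_right J k) ε₀ V ≤
      (F.scheme ℰp γ).β (J + k + 1) * minActionRegPr F J (J + k + 1) (Nat.le_add_right J (k + 1)) ε₀ V +
        (F.scheme ℰp γ).β (J + k) * (E₂ * ((B₄ * θ * (((k + 1 : ℕ) : ℝ) + 1) * ((F.L : ℝ)⁻¹) ^ (3 * (k + 1))) ^ 2 +
          (B₃ * θ * ((F.L : ℝ)⁻¹) ^ (2 * (k + 1))) * (B₄ * θ * (((k + 1 : ℕ) : ℝ) + 1) * ((F.L : ℝ)⁻¹) ^ (3 * (k + 1))) +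
          (B₃ * θ * ((F.L : ℝ)⁻¹) ^ (2 * (k + 1))) ^ 3) * (F.L : ℝ) ^ (3 * (F.m + (J + k + 1)))) := by
  obtain ⟨hac', hbc', -⟩ := ab_le F hB₃ hB₄ hθ (k + 1)
  have ha0 : 0 ≤ B₃ * θ * ((F.L : ℝ)⁻¹) ^ (2 * (k + 1)) := by positivity
  have hb0 : 0 ≤ B₄ * θ * (((k + 1 : ℕ) : ℝ) + 1) * ((F.L : ℝ)⁻¹) ^ (3 * (k + 1)) := by positivity
  have hbc'' : B₄ * θ * (((k + 1 : ℕ) : ℝ) + 1) * ((F.L : ℝ)⁻¹) ^ (3 * (k + 1)) ≤ e := by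
    have h : (((k + 1 : ℕ) : ℝ) + 1) = ((k : ℝ) + 1) + 1 := by push_cast; ring
    have h' : B₄ * θ * ((((k + 1 : ℕ) : ℝ)) + 1) * ((F.L : ℝ)⁻¹) ^ (3 * (k + 1)) =
        B₄ * θ * ((((k + 1 : ℕ) : ℝ)) + 1) * ((F.L : ℝ)⁻¹) ^ (3 * (k + 1)) := rfl
    have hbc₁ : B₄ * θ * ((((k + 1 : ℕ)) : ℝ) + 1) * ((F.L : ℝ)⁻¹) ^ (3 * (k + 1)) ≤ B₄ * θ := by
      have := hbc'
      push_cast at this ⊢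
      exact this
    exact hbc₁.trans hB₄e
  have hAvg := hAD F hFL (J + k) _ _ ha0 (hac'.trans hB₃e) hb0 hbc'' U' hU'a hgrad'
  -- the average lies in the fibre of `V` and has a good history
  have hf : descendTo F ℰp (J + k) (J + k + 1) (Nat.le_succ (J + k)) U' ∈ fibre F ℰp J (J + k) (Nat.le_add_right J k) V :=
    descendTo_mem_fibre F ℰp (Nat.le_add_right J k) (Nat.le_succ (J + k)) hU'f
  have hh : descendTo F ℰp (J + k) (J + k + 1) (Nat.le_succ (J + k)) U' ∈ histGood F ℰp Θ (J + k) J := histGood_descendTo_succ F hU'h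
  have hmin := hE _ hf hh
  have hβ := F.scheme_β_nonneg ℰp hγ (J + k)
  rw [scheme_β_succ]
  calc (F.scheme ℰp γ).β (J + k) * minActionRegPr F J (J + k) (Nat.le_add_right J k) ε₀ V
      ≤ (F.scheme ℰp γ).β (J + k) * wilsonAction4 (descendTo F ℰp (J + k) (J + k + 1) (Nat.le_succ (J + k)) U') :=
        mul_le_mul_of_nonneg_left hmin hβ
    _ ≤ (F.scheme ℰp γ).β (J + k) * ((F.L : ℝ) * wilsonAction4 U' +
          E₂ * ((B₄ * θ * (((k + 1 : ℕ) : ℝ) + 1) * ((F.L : ℝ)⁻¹) ^ (3 * (k + 1))) ^ 2 +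
          (B₃ * θ * ((F.L : ℝ)⁻¹) ^ (2 * (k + 1))) * (B₄ * θ * (((k + 1 : ℕ) : ℝ) + 1) * ((F.L : ℝ)⁻¹) ^ (3 * (k + 1))) +
          (B₃ * θ * ((F.L : ℝ)⁻¹) ^ (2 * (k + 1))) ^ 3) * (F.L : ℝ) ^ (3 * (F.m + (J + k + 1)))) := mul_le_mul_of_nonneg_left hAvg hβ
    _ = _ := by rw [hU'm]; ring

/-- The UPPER defect of one step, weighted by `β_K`, is below `C₂·M·G·(k+2)²·x^k` (`M = B₄² + B₃B₄ + B₃³`, `G = L^{3m}L^{4J}/γ`, `θ ≤ 1`). [cite: Balaban1985UV3, (3) and (5) p.256] -/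
theorem upper_radius_le {γ : ℝ} (hγ : 0 < γ) {B₃ B₄ C₂ θ : ℝ} (hB₃ : 0 ≤ B₃) (hB₄ : 0 ≤ B₄) (hC₂ : 0 ≤ C₂) (hθ : 0 ≤ θ) (hθ1 : θ ≤ 1) (J k : ℕ) :
    (F.scheme ℰp γ).β (J + k) * (C₂ * ((B₄ * θ * ((k : ℝ) + 1) * ((F.L : ℝ)⁻¹) ^ (3 * k)) ^ 2 +
          (B₃ * θ * ((F.L : ℝ)⁻¹) ^ (2 * k)) * (B₄ * θ * ((k : ℝ) + 1) * ((F.L : ℝ)⁻¹) ^ (3 * k)) +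
          (B₃ * θ * ((F.L : ℝ)⁻¹) ^ (2 * k)) ^ 3) * (F.L : ℝ) ^ (3 * (F.m + (J + k)))) ≤
      C₂ * (B₄ ^ 2 + B₃ * B₄ + B₃ ^ 3) * ((F.L : ℝ) ^ (3 * F.m) * (F.L : ℝ) ^ (4 * J) / γ) * ((k : ℝ) + 2) ^ 2 * ((F.L : ℝ)⁻¹) ^ k := by
  have hL0 : (0 : ℝ) < F.L := by have := F.hL.2; exact_mod_cast (by omega : 0 < F.L)
  have hβ := F.scheme_β_nonneg ℰp hγ.le (J + k)
  have h1 := defect_log_le F (C := C₂) hB₃ hB₄ hC₂ hθ1 k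
  have h2 := mul_le_mul_of_nonneg_left (mul_le_mul_of_nonneg_right h1 (pow_nonneg hL0.le (3 * (F.m + (J + k))))) hβ
  rw [beta_mul_scale_upper] at h2
  refine h2.trans ?_
  have hk : ((k : ℝ) + 1) ^ 2 * θ ^ 2 ≤ ((k : ℝ) + 2) ^ 2 := by
    have hθ2 : θ ^ 2 ≤ 1 := pow_le_one₀ hθ hθ1
    have hk1 : ((k : ℝ) + 1) ^ 2 ≤ ((k : ℝ) + 2) ^ 2 := by
      have := Nat.cast_nonneg (α := ℝ) k; nlinarith
    calc ((k : ℝ) + 1) ^ 2 * θ ^ 2 ≤ ((k : ℝ) + 1) ^ 2 * 1 := mul_le_mul_of_nonneg_left hθ2 (sq_nonneg _)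
      _ ≤ ((k : ℝ) + 2) ^ 2 := by rw [mul_one]; exact hk1
  have hG : 0 ≤ C₂ * (B₄ ^ 2 + B₃ * B₄ + B₃ ^ 3) * ((F.L : ℝ) ^ (3 * F.m) * (F.L : ℝ) ^ (4 * J) / γ) * ((F.L : ℝ)⁻¹) ^ k := by positivity
  have e1 : C₂ * (B₄ ^ 2 + B₃ * B₄ + B₃ ^ 3) * ((k : ℝ) + 1) ^ 2 * θ ^ 2 * (F.L : ℝ) ^ (3 * F.m) * (F.L : ℝ) ^ (4 * J) / γ * ((F.L : ℝ)⁻¹) ^ k =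
      (C₂ * (B₄ ^ 2 + B₃ * B₄ + B₃ ^ 3) * ((F.L : ℝ) ^ (3 * F.m) * (F.L : ℝ) ^ (4 * J) / γ) * ((F.L : ℝ)⁻¹) ^ k) * (((k : ℝ) + 1) ^ 2 * θ ^ 2) := by ring
  have e2 : C₂ * (B₄ ^ 2 + B₃ * B₄ + B₃ ^ 3) * ((F.L : ℝ) ^ (3 * F.m) * (F.L : ℝ) ^ (4 * J) / γ) * ((k : ℝ) + 2) ^ 2 * ((F.L : ℝ)⁻¹) ^ k =
      (C₂ * (B₄ ^ 2 + B₃ * B₄ + B₃ ^ 3) * ((F.L : ℝ) ^ (3 * F.m) * (F.L : ℝ) ^ (4 * J) / γ) * ((F.L : ℝ)⁻¹) ^ k) * ((k : ℝ) + 2) ^ 2 := by ring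
  rw [e1, e2]
  exact mul_le_mul_of_nonneg_left hk hG

/-- The LOWER defect of one step, weighted by `β_K`, is below `E₂·M·G·(k+2)²·x^k`. [cite: Balaban1985UV3, (3) and (5) p.256] -/
theorem lower_radius_le {γ : ℝ} (hγ : 0 < γ) {B₃ B₄ E₂ θ : ℝ} (hB₃ : 0 ≤ B₃) (hB₄ : 0 ≤ B₄) (hE₂ : 0 ≤ E₂) (hθ : 0 ≤ θ) (hθ1 : θ ≤ 1) (J k : ℕ) :
    (F.scheme ℰp γ).β (J + k) * (E₂ * ((B₄ * θ * (((k + 1 : ℕ) : ℝ) + 1) * ((F.L : ℝ)⁻¹) ^ (3 * (k + 1))) ^ 2 +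
          (B₃ * θ * ((F.L : ℝ)⁻¹) ^ (2 * (k + 1))) * (B₄ * θ * (((k + 1 : ℕ) : ℝ) + 1) * ((F.L : ℝ)⁻¹) ^ (3 * (k + 1))) +
          (B₃ * θ * ((F.L : ℝ)⁻¹) ^ (2 * (k + 1))) ^ 3) * (F.L : ℝ) ^ (3 * (F.m + (J + k + 1)))) ≤
      E₂ * (B₄ ^ 2 + B₃ * B₄ + B₃ ^ 3) * ((F.L : ℝ) ^ (3 * F.m) * (F.L : ℝ) ^ (4 * J) / γ) * ((k : ℝ) + 2) ^ 2 * ((F.L : ℝ)⁻¹) ^ k := by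
  have hL0 : (0 : ℝ) < F.L := by have := F.hL.2; exact_mod_cast (by omega : 0 < F.L)
  have hx0 : (0 : ℝ) ≤ (F.L : ℝ)⁻¹ := inv_nonneg.mpr hL0.le
  have hx1 : ((F.L : ℝ)⁻¹) ≤ 1 := inv_le_one_of_one_le₀ (by have := F.hL.2; exact_mod_cast (by omega : 1 ≤ F.L))
  have hβ := F.scheme_β_nonneg ℰp hγ.le (J + k)
  have h1 := defect_log_le F (C := E₂) hB₃ hB₄ hE₂ hθ1 (k + 1)
  have h2 := mul_le_mul_of_nonneg_left (mul_le_mul_of_nonneg_right h1 (pow_nonneg hL0.le (3 * (F.m + (J + k + 1))))) hβ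
  rw [beta_mul_scale_lower] at h2
  refine h2.trans ?_
  have hk : ((((k + 1 : ℕ) : ℝ)) + 1) ^ 2 * θ ^ 2 * ((F.L : ℝ)⁻¹) ^ (k + 2) ≤ ((k : ℝ) + 2) ^ 2 * ((F.L : ℝ)⁻¹) ^ k := by
    have hθ2 : θ ^ 2 ≤ 1 := pow_le_one₀ hθ hθ1
    have hk2 : ((((k + 1 : ℕ) : ℝ)) + 1) ^ 2 = ((k : ℝ) + 2) ^ 2 := by push_cast; ring
    have hxk : ((F.L : ℝ)⁻¹) ^ (k + 2) ≤ ((F.L : ℝ)⁻¹) ^ k := pow_le_pow_of_le_one hx0 hx1 (by omega)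
    rw [hk2]
    calc ((k : ℝ) + 2) ^ 2 * θ ^ 2 * ((F.L : ℝ)⁻¹) ^ (k + 2) = ((k : ℝ) + 2) ^ 2 * (θ ^ 2 * ((F.L : ℝ)⁻¹) ^ (k + 2)) := by ring
      _ ≤ ((k : ℝ) + 2) ^ 2 * (1 * ((F.L : ℝ)⁻¹) ^ k) :=
          mul_le_mul_of_nonneg_left (mul_le_mul hθ2 hxk (pow_nonneg hx0 _) zero_le_one) (sq_nonneg _)
      _ = ((k : ℝ) + 2) ^ 2 * ((F.L : ℝ)⁻¹) ^ k := by rw [one_mul]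
  have hG : 0 ≤ E₂ * (B₄ ^ 2 + B₃ * B₄ + B₃ ^ 3) * ((F.L : ℝ) ^ (3 * F.m) * (F.L : ℝ) ^ (4 * J) / γ) := by positivity
  have e1 : E₂ * (B₄ ^ 2 + B₃ * B₄ + B₃ ^ 3) * ((((k + 1 : ℕ) : ℝ)) + 1) ^ 2 * θ ^ 2 * (F.L : ℝ) ^ (3 * F.m) * (F.L : ℝ) ^ (4 * J) / γ *
        ((F.L : ℝ)⁻¹) ^ (k + 2) =
      (E₂ * (B₄ ^ 2 + B₃ * B₄ + B₃ ^ 3) * ((F.L : ℝ) ^ (3 * F.m) * (F.L : ℝ) ^ (4 * J) / γ)) *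
        (((((k + 1 : ℕ) : ℝ)) + 1) ^ 2 * θ ^ 2 * ((F.L : ℝ)⁻¹) ^ (k + 2)) := by ring
  have e2 : E₂ * (B₄ ^ 2 + B₃ * B₄ + B₃ ^ 3) * ((F.L : ℝ) ^ (3 * F.m) * (F.L : ℝ) ^ (4 * J) / γ) * ((k : ℝ) + 2) ^ 2 * ((F.L : ℝ)⁻¹) ^ k =
      (E₂ * (B₄ ^ 2 + B₃ * B₄ + B₃ ^ 3) * ((F.L : ℝ) ^ (3 * F.m) * (F.L : ℝ) ^ (4 * J) / γ)) * (((k : ℝ) + 2) ^ 2 * ((F.L : ℝ)⁻¹) ^ k) := by ring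
  rw [e1, e2]
  exact mul_le_mul_of_nonneg_left hk hG

/-- The two defects of one step, weighted by `β_K`, are below `D·(k+2)²·x^k` with `D = (C₂ + E₂)(B₄² + B₃B₄ + B₃³)·L^{3m}L^{4J}/γ` (`θ ≤ 1`). [cite: Balaban1985UV3, (3) and (5) p.256] -/
theorem step_radius_le {γ : ℝ} (hγ : 0 < γ) {B₃ B₄ C₂ E₂ θ : ℝ} (hB₃ : 0 ≤ B₃) (hB₄ : 0 ≤ B₄) (hC₂ : 0 ≤ C₂) (hE₂ : 0 ≤ E₂)
    (hθ : 0 ≤ θ) (hθ1 : θ ≤ 1) (J k : ℕ) :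
    (F.scheme ℰp γ).β (J + k) * (C₂ * ((B₄ * θ * ((k : ℝ) + 1) * ((F.L : ℝ)⁻¹) ^ (3 * k)) ^ 2 +
          (B₃ * θ * ((F.L : ℝ)⁻¹) ^ (2 * k)) * (B₄ * θ * ((k : ℝ) + 1) * ((F.L : ℝ)⁻¹) ^ (3 * k)) +
          (B₃ * θ * ((F.L : ℝ)⁻¹) ^ (2 * k)) ^ 3) * (F.L : ℝ) ^ (3 * (F.m + (J + k)))) +
      (F.scheme ℰp γ).β (J + k) * (E₂ * ((B₄ * θ * (((k + 1 : ℕ) : ℝ) + 1) * ((F.L : ℝ)⁻¹) ^ (3 * (k + 1))) ^ 2 +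
          (B₃ * θ * ((F.L : ℝ)⁻¹) ^ (2 * (k + 1))) * (B₄ * θ * (((k + 1 : ℕ) : ℝ) + 1) * ((F.L : ℝ)⁻¹) ^ (3 * (k + 1))) +
          (B₃ * θ * ((F.L : ℝ)⁻¹) ^ (2 * (k + 1))) ^ 3) * (F.L : ℝ) ^ (3 * (F.m + (J + k + 1)))) ≤
      ((C₂ + E₂) * (B₄ ^ 2 + B₃ * B₄ + B₃ ^ 3) * ((F.L : ℝ) ^ (3 * F.m) * (F.L : ℝ) ^ (4 * J) / γ)) * ((k : ℝ) + 2) ^ 2 * ((F.L : ℝ)⁻¹) ^ k := by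
  have hU := upper_radius_le F hγ hB₃ hB₄ hC₂ hθ hθ1 J k
  have hL := lower_radius_le F hγ hB₃ hB₄ hE₂ hθ hθ1 J k
  have e : ((C₂ + E₂) * (B₄ ^ 2 + B₃ * B₄ + B₃ ^ 3) * ((F.L : ℝ) ^ (3 * F.m) * (F.L : ℝ) ^ (4 * J) / γ)) * ((k : ℝ) + 2) ^ 2 * ((F.L : ℝ)⁻¹) ^ k =
      C₂ * (B₄ ^ 2 + B₃ * B₄ + B₃ ^ 3) * ((F.L : ℝ) ^ (3 * F.m) * (F.L : ℝ) ^ (4 * J) / γ) * ((k : ℝ) + 2) ^ 2 * ((F.L : ℝ)⁻¹) ^ k +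
      E₂ * (B₄ ^ 2 + B₃ * B₄ + B₃ ^ 3) * ((F.L : ℝ) ^ (3 * F.m) * (F.L : ℝ) ^ (4 * J) / γ) * ((k : ℝ) + 2) ^ 2 * ((F.L : ℝ)⁻¹) ^ k := by ring
  rw [e]
  exact add_le_add hU hL

end Steps

/-! ## §4 The step at positive depth from EXW∘'s two clauses at two consecutive runs -/

section Succ

variable (F : T3Family)

/-- **THE STEP AT POSITIVE DEPTH** `k + 1 → k + 2` (all data explicit): from EXW∘'s two clauses at `(J, J+k+1)` and `(J, J+k+2)` for ONE interior datum `V`, Prop 8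
(`MinimisersIn8At`), the log-Lipschitz curvature gradient of (8)-regular fields (`CritCurvGradLogAt`), the smooth exact lift (`SmoothLiftAt`) and the averaging action
defect (`AvgActionDefectAt`): `|β_{K+1}·m_{K+1}(V) − β_K·m_K(V)| ≤ D·(k+3)²·x^{k+1}`, `K = J + k + 1`.
[cite: Balaban1985Variational, Thm 1 (8)-(10) p.279, Prop. 8 p.304; Balaban1985UV3, (41) p.266] -/
theorem step_succ {L : ℕ} (hFL : F.L = L) {γ : ℝ} (hγ : 0 < γ)
    {a₅ a₁ B₃ B₄ C₁ C₂ c E₂ e θ ε₀ : ℝ} (hB₃ : 0 < B₃) (hB₄ : 0 < B₄) (hC₁ : 0 < C₁) (hC₂ : 0 ≤ C₂) (hE₂ : 0 ≤ E₂)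
    (hIn8 : MinimisersIn8At L a₅ 1 B₃) (hCG : CritCurvGradLogAt L a₁ B₃ B₄) (hSL : SmoothLiftAt L C₁ C₂ c) (hAD : AvgActionDefectAt L E₂ e)
    (hθpos : 0 < θ) (hθ1 : θ ≤ 1) (hθa₁ : θ ≤ a₁) (hε₀ : 0 < ε₀) (hε₀a : ε₀ ≤ a₅) (hB₃θ : B₃ * θ ≤ ε₀)
    (hB₃c : B₃ * θ ≤ c) (hB₄c : B₄ * θ ≤ c) (hB₃e : B₃ * θ ≤ e) (hB₄e : B₄ * θ ≤ e)
    {Θ : ℕ → ℝ} (J k : ℕ) (htop : C₁ * ((B₃ + B₄) * θ * ((F.L : ℝ)⁻¹) ^ (2 * (k + 1))) ≤ Θ (J + (k + 1) + 1))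
    {V : GaugeField (F.P J) 0 (Matrix.specialUnitaryGroup (Fin 2) ℂ)} (hVθ : PlaqSmall θ V)
    (hWK : (∀ U ∈ fibre F ℰp J (J + (k + 1)) (Nat.le_add_right J (k + 1)) V, U ∈ histGood F ℰp Θ (J + (k + 1)) J →
        minActionRegPr F J (J + (k + 1)) (Nat.le_add_right J (k + 1)) ε₀ V ≤ wilsonAction4 U) ∧
      (∃ U₀ ∈ regFibrePr F J (J + (k + 1)) (Nat.le_add_right J (k + 1)) ε₀ V, U₀ ∈ histGood F ℰp Θ (J + (k + 1)) J ∧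
        wilsonAction4 U₀ = minActionRegPr F J (J + (k + 1)) (Nat.le_add_right J (k + 1)) ε₀ V))
    (hWK1 : (∀ U ∈ fibre F ℰp J (J + (k + 1) + 1) (Nat.le_add_right J (k + 1 + 1)) V, U ∈ histGood F ℰp Θ (J + (k + 1) + 1) J →
        minActionRegPr F J (J + (k + 1) + 1) (Nat.le_add_right J (k + 1 + 1)) ε₀ V ≤ wilsonAction4 U) ∧
      (∃ U₀ ∈ regFibrePr F J (J + (k + 1) + 1) (Nat.le_add_right J (k + 1 + 1)) ε₀ V, U₀ ∈ histGood F ℰp Θ (J + (k + 1) + 1) J ∧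
        wilsonAction4 U₀ = minActionRegPr F J (J + (k + 1) + 1) (Nat.le_add_right J (k + 1 + 1)) ε₀ V)) :
    |(F.scheme ℰp γ).β (J + (k + 1) + 1) * minActionRegPr F J (J + (k + 1) + 1) (Nat.le_add_right J (k + 1 + 1)) ε₀ V -
        (F.scheme ℰp γ).β (J + (k + 1)) * minActionRegPr F J (J + (k + 1)) (Nat.le_add_right J (k + 1)) ε₀ V| ≤
      ((C₂ + E₂) * (B₄ ^ 2 + B₃ * B₄ + B₃ ^ 3) * ((F.L : ℝ) ^ (3 * F.m) * (F.L : ℝ) ^ (4 * J) / γ)) *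
        (((k + 1 : ℕ) : ℝ) + 2) ^ 2 * ((F.L : ℝ)⁻¹) ^ (k + 1) := by
  have hlt : J < J + (k + 1) := by omega
  have hlt' : J < J + (k + 1) + 1 := by omega
  obtain ⟨hEK, U₀, hU₀6, hU₀h, hU₀m⟩ := hWK
  obtain ⟨hEK1, U₁, hU₁6, hU₁h, hU₁m⟩ := hWK1
  -- (8)-regularity of the two minimisers (Prop 8)
  have hU₀8 : U₀ ∈ regFibrePr F J (J + (k + 1)) (Nat.le_add_right J (k + 1)) (B₃ * θ) V :=
    hIn8 F hFL J (J + (k + 1)) hlt θ ε₀ hθpos hθ1 hB₃θ hε₀a V hVθ U₀ hU₀6 (isMinOn_of_eq_minActionRegPr F hU₀m)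
  have hU₁8 : U₁ ∈ regFibrePr F J (J + (k + 1) + 1) (Nat.le_add_right J (k + 1 + 1)) (B₃ * θ) V :=
    hIn8 F hFL J (J + (k + 1) + 1) hlt' θ ε₀ hθpos hθ1 hB₃θ hε₀a V hVθ U₁ hU₁6 (isMinOn_of_eq_minActionRegPr F hU₁m)
  have hU₀a : PlaqSmall (B₃ * θ * ((F.L : ℝ)⁻¹) ^ (2 * (k + 1))) U₀ := by
    have h := ((mem_regFibrePr_iff F).mp hU₀8).2.1
    simp only [regThreshold, Nat.add_sub_cancel_left] at h
    exact h
  have hU₁a : PlaqSmall (B₃ * θ * ((F.L : ℝ)⁻¹) ^ (2 * (k + 1 + 1))) U₁ := by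
    have h := ((mem_regFibrePr_iff F).mp hU₁8).2.1
    simp only [regThreshold, show J + (k + 1) + 1 - J = k + 1 + 1 by omega] at h
    exact h
  -- the log-Lipschitz curvature gradients
  have hg₀ : ∀ (x : Site (F.P (J + (k + 1))) 0) (ν κ κ' : Fin (F.P (J + (k + 1))).d), κ ≠ κ' →
      ‖covDerivT 1 (unitsField (toUField U₀)) ν (plaqFT (unitsField (toUField U₀)) κ κ') x‖ ≤
        B₄ * θ * (((k + 1 : ℕ) : ℝ) + 1) * ((F.L : ℝ)⁻¹) ^ (3 * (k + 1)) := by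
    intro x ν κ κ' hne
    have h := hCG F hFL J (J + (k + 1)) hlt θ hθpos hθa₁ V hVθ U₀ ((mem_regFibrePr_iff F).mp hU₀8).2 hU₀8.1.1
      ⟨ε₀, hε₀, hU₀6, isMinOn_of_eq_minActionRegPr F hU₀m⟩ x ν κ κ' hne
    rw [Nat.add_sub_cancel_left] at h
    exact h.le
  have hg₁ : ∀ (x : Site (F.P (J + (k + 1) + 1)) 0) (ν κ κ' : Fin (F.P (J + (k + 1) + 1)).d), κ ≠ κ' →
      ‖covDerivT 1 (unitsField (toUField U₁)) ν (plaqFT (unitsField (toUField U₁)) κ κ') x‖ ≤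
        B₄ * θ * (((k + 1 + 1 : ℕ) : ℝ) + 1) * ((F.L : ℝ)⁻¹) ^ (3 * (k + 1 + 1)) := by
    intro x ν κ κ' hne
    have h := hCG F hFL J (J + (k + 1) + 1) hlt' θ hθpos hθa₁ V hVθ U₁ ((mem_regFibrePr_iff F).mp hU₁8).2 hU₁8.1.1
      ⟨ε₀, hε₀, hU₁6, isMinOn_of_eq_minActionRegPr F hU₁m⟩ x ν κ κ' hne
    rw [show J + (k + 1) + 1 - J = k + 1 + 1 by omega] at h
    exact h.le
  -- UPPER, LOWER, the radius
  have hup := upper_step F hFL hC₁.le hSL hγ.le hB₃.le hB₄.le hθpos.le hB₃c hB₄c (Θ := Θ) J (k + 1)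
    htop hU₀6.1.1 hU₀a hU₀h hU₀m hg₀ hEK1
  have hlow := lower_step F hFL hAD hγ.le hB₃.le hB₄.le hθpos.le hB₃e hB₄e (Θ := Θ) J (k + 1)
    hU₁6.1.1 hU₁a hU₁h hU₁m hg₁ hEK
  have hrad := step_radius_le F hγ hB₃.le hB₄.le hC₂ hE₂ hθpos.le hθ1 J (k + 1)
  have hβ := F.scheme_β_nonneg ℰp hγ.le (J + (k + 1))
  have hLp : ∀ n : ℕ, (0 : ℝ) ≤ (F.L : ℝ) ^ n := fun n => pow_nonneg (Nat.cast_nonneg _) n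
  exact abs_sub_le_of_two_sided hup hlow hrad (defect_nonneg F hB₃.le hB₄.le hC₂ hθpos.le hβ (hLp _) (k + 1) (k + 1))
    (defect_nonneg F hB₃.le hB₄.le hE₂ hθpos.le hβ (hLp _) (k + 1 + 1) (k + 1 + 1))

end Succ

end Summit.QuantumFields.YangMills.Theorems.FluctuationComparisonRegPrIntLClassicalPerHeightOneStep

end
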